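import Summits.RiemannHypothesis.RiemannHypothesis.Theses.SignCone
import Literature.NumberTheory.LFunctions.WeilExplicit
import Literature.NumberTheory.LFunctions.WeilExplicitProofs
import Literature.NumberTheory.LFunctions.WeilMellinInversion
import Literature.NumberTheory.LFunctions.WeilMellinPolyDecay
import Literature.NumberTheory.LFunctions.EulerMaclaurinZeta
import Literature.NumberTheory.LFunctions.WeilArchimedeanPositivityProofs
import Literature.NumberTheory.LFunctions.WeilArchimedeanMoments
import Summits.RiemannHypothesis.RiemannHypothesis.Theorems.SignConeSignConeOscillatoryStubPolePairing
import Summits.RiemannHypothesis.RiemannHypothesis.Theorems.SignConeSignConeOscillatoryStubRemainderPairing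
import Summits.RiemannHypothesis.RiemannHypothesis.Theorems.SignConeSignConeOscillatoryStubZetaLineIntegrable
import Summits.RiemannHypothesis.RiemannHypothesis.Theorems.SignConeSignConeOscillatoryStubSpectralArchPolar
import Summits.RiemannHypothesis.RiemannHypothesis.Theorems.SignConeSignConeOscillatoryStubCombPairing
import Summits.RiemannHypothesis.RiemannHypothesis.Theorems.SignConeSignConeOscillatoryStubCertificateSuffices
import Summits.RiemannHypothesis.RiemannHypothesis.Theorems.SignConeSignConeOscillatoryOfFakeZeroMeasure
import Summits.RiemannHypothesis.RiemannHypothesis.Theorems.SignConeSignConeOscillatoryStubFakeZeroMeasureOfRH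

/-!
# `SignCone.SignConeOscillatory` — line `Sketch` (spectral fake-zero certificate)
(item stmt-RiemannHypothesis-16302, route route-RiemannHypothesis-SignCone)

THE CRUX (#2 of route SignCone): for every cutoff `a > 0` and every finite family of Weil tests `gᵢ`
supported in `[-a, a]` whose autocorrelation sum `F = Σᵢ gᵢ ⋆ g̃ᵢ` is non-negative at the nodes `log n`
(`n ≥ 2`) and has `Re F(t) < 0` somewhere with `|t| ≥ log 2`, the archimedean-plus-polar part of Weil's
functional satisfies `Re W_ar(F) ≥ -Re F(0)`, `W_ar = weilPolarTerm + weilArchTerm`.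

STATUS OF THE CRUX (kernel-checked before this line opened): `RiemannHypothesis → crux` (p128354);
`crux ↔ SignConeInequality` (p129083); `crux ↔ RiemannHypothesis` given the sibling cruxes (p128545). Hence
every composition ends in ONE RH-strength stub. This skeleton isolates it as `stub_fakeZeroMeasure` (held by
the lead, never delegated) and makes every other stub an exact, provable identity.

LINE (cards `Ideas/krein-fake-zero-certificate.md` for the shape, `Ideas/mellin-side-polar-transfer.md` for
the engine). Write `ĝ(y) := weilMellin g (1/2 + iy)` (the Fourier transform of `g`), `k = g ⋆ g̃`
(`k̂(1/2+iy) = |ĝ(y)|²`), `ζ_N(s) = Σ_{n ≤ N} n^{-s}` and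
`J_N(y) := 2 Re(ζ − ζ_N)(1/2 + iy) − Re ψ(1/4 + iy/2) + log π − 1`.
* ENGINE (card A, Euler–Maclaurin `ν = 0` paired with `k̂` on the critical line): for a Weil test `F` with
  `tsupport F ⊆ (-∞, log N]`, `∫ F̂(y) ζ(1/2+iy) dy = 2π Σ_{n ≤ N} F(log n)/√n − 2π F̂(1)`
  (`polarNodeZeta`, composed here from `stub_polePairing`, `stub_remainderPairing`, `stub_zetaLineIntegrable`
  and the tree's `riemannZeta_eq_eulerMaclaurin₀`, `integral_weilMellin_vertical_mul_natCast_cpow`).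
* SPECTRAL FORM (`stub_spectralArchPolar`, Yoshida-form bookkeeping): for `tsupport g ⊆ [-a, a]`, `e^{2a} ≤ N`,
  `Re W_ar(k) + ‖g‖₂² = −(1/2π) ∫ |ĝ(y)|² J_N(y) dy`.
* NODES (`stub_combPairing`): `(1/2π) ∫ |ĝ(y)|² Σ_{2≤n≤N} cₙ 2cos(y log n)/√n dy = Σ cₙ 2 Re k(log n)/√n = P_c(k)`.
* CERTIFICATE ⇒ CRUX (`stub_certificateSuffices`): if `Re W_ar(kᵢ) + ‖gᵢ‖² − P_c(kᵢ) = ∫ |ĝᵢ|² dσ` for every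
  `i` with `c ≥ 0`, `σ ≥ 0`, then on node-nonnegative `F = Σ kᵢ`: `Re W_ar(F) + Re F(0) ≥ P_c(F) ≥ 0`.
* TERMINAL (`stub_fakeZeroMeasure`, RH-strength, RH-implied with `(c, σ) = (Λ, dy/2π + Σ_ρ m_ρ δ_γ)` by
  `explicit_formula_holds`): at every cutoff some `c ≥ 0`, `σ ≥ 0` satisfy the spectral certificate identity.

Dictionary (verbatim expansions, no local `def`):
* `ĝ(y)`     ↦ `weilMellin g (1 / 2 + y * I)`;   `k` ↦ `weilConv g (weilReflect g)`
* `J_N(y)`   ↦ `2 * (riemannZeta (1 / 2 + y * I) - ∑ n ∈ Finset.Icc 1 N, (n : ℂ) ^ (-(1 / 2 + y * I))).re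
               - (Complex.digamma (1 / 4 + y / 2 * I)).re + Real.log π - 1`
* `comb_c(y)` ↦ `∑ n ∈ Finset.Icc 2 N, c n * (2 * Real.cos (y * Real.log n)) / Real.sqrt n`

Stubs (registered on the item): LANDED — `stub_polePairing` (p130052), `stub_remainderPairing` (p130251),
`stub_zetaLineIntegrable` (p130396), `stub_spectralArchPolar` (p130486), `stub_combPairing` (p130378),
`stub_certificateSuffices` (p130386), each in its own `Theorems/SignConeSignConeOscillatoryStub*.lean`; and the
composition minus the terminal stub — `stub_polarNodeZeta`, `stub_spectralForm`, `stub_reduction` with corollaries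
`polarNodeZeta`, `spectralArchPolar`, `certificate_of_spectralCertificate`, `signConeOscillatory_of_fakeZeroMeasure` —
in `Theorems/SignConeSignConeOscillatoryOfFakeZeroMeasure.lean` (p130690); and the RH-envelope of the terminal stub,
`stub_fakeZeroMeasure_of_riemannHypothesis` (p131143, `Theorems/SignConeSignConeOscillatoryStubFakeZeroMeasureOfRH.lean`).
OPEN — only `stub_fakeZeroMeasure` (terminal, RH-strength, held by the lead). Composition here: `SignConeOscillatory_of`
(the crux BY NAME, = `stub_reduction stub_fakeZeroMeasure`); the RH-sandwich RH ⇒ terminal stub ⇒ crux is landed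
(p131143 + p130690) and recalled at the end.
-/

noncomputable section

-- `Summit.RiemannHypothesis.RiemannHypothesis.…` repeats a namespace component by design (D-0017 layout).
set_option linter.dupNamespace false

open scoped BigOperators ComplexConjugate Real
open Complex MeasureTheory Set Filter

namespace Summit.RiemannHypothesis.RiemannHypothesis.Theorems.SignConeOscillatory

open Literature.NumberTheory.LFunctions

/-! ### Stubs

LANDED (imported above, same namespace): `stub_polePairing`, `stub_remainderPairing`, `stub_zetaLineIntegrable`,
`stub_spectralArchPolar`, `stub_combPairing`, `stub_certificateSuffices`, `stub_polarNodeZeta`, `stub_spectralForm`,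
`stub_reduction`, `stub_fakeZeroMeasure_of_riemannHypothesis` (the RH-envelope, p131143). OPEN: only the terminal
stub below. -/

/-- TERMINAL STUB (RH-strength; held by the lead). SPECTRAL FAKE-ZERO CERTIFICATE AT EVERY CUTOFF: for every
`a > 0` there are `N ≥ e^{2a}`, a non-negative weight `c` ("fake von Mangoldt") and a positive measure `σ` on
the critical line ("fake zeros") with
`-(1/2π)∫|ĝ|² J_N − (1/2π)∫|ĝ|² comb_c = ∫ |ĝ|² dσ` for every Weil test `g` supported in `[-a, a]`.
Under RH it holds with `c = Λ`, `σ = dy/2π + Σ_ρ m_ρ δ_{Im ρ}` (explicit formula;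
`stub_fakeZeroMeasure_of_riemannHypothesis`); it implies the crux (`stub_reduction`, landed) and follows from it
modulo `SignConeDuality` (closed) and the Krein–Schwartz extension theorem, so it is exactly as hard as the crux. -/
theorem stub_fakeZeroMeasure :
    ∀ a : ℝ, 0 < a → ∃ N : ℕ, Real.exp (2 * a) ≤ N ∧ ∃ c : ℕ → ℝ, (∀ n, 0 ≤ c n) ∧ ∃ σ : Measure ℝ, ∀ g : ℝ → ℂ, IsWeilTest g → tsupport g ⊆ Set.Icc (-a) a → Integrable (fun y : ℝ => ‖weilMellin g (1 / 2 + y * I)‖ ^ 2) σ ∧ -(1 / (2 * π)) * (∫ y : ℝ, ‖weilMellin g (1 / 2 + y * I)‖ ^ 2 * (2 * (riemannZeta (1 / 2 + y * I) - ∑ n ∈ Finset.Icc 1 N, (n : ℂ) ^ (-(1 / 2 + y * I))).re - (Complex.digamma (1 / 4 + y / 2 * I)).re + Real.log π - 1)) - 1 / (2 * π) * (∫ y : ℝ, ‖weilMellin g (1 / 2 + y * I)‖ ^ 2 * ∑ n ∈ Finset.Icc 2 N, c n * (2 * Real.cos (y * Real.log n)) / Real.sqrt n) = ∫ y : ℝ,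 ‖weilMellin g (1 / 2 + y * I)‖ ^ 2 ∂σ := by
  sorry

/-! ### The composition -/

open Summit.RiemannHypothesis.RiemannHypothesis.Theses.SignCone in
/-- **The crux by name.** `SignConeOscillatory` = `stub_reduction` (landed: the sorry-free composition of the
six analytic/bookkeeping stubs, `Theorems/SignConeSignConeOscillatoryOfFakeZeroMeasure.lean`) applied to the
terminal stub `stub_fakeZeroMeasure`. The skeleton is CLOSED MODULO `{stub_fakeZeroMeasure}`. -/
theorem SignConeOscillatory_of : SignConeOscillatory :=
  signConeOscillatory_of_fakeZeroMeasure stub_fakeZeroMeasure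

/-! ### The RH-sandwich of the terminal stub (landed, not restated here)

`RiemannHypothesis → stub_fakeZeroMeasure`'s statement is `fakeZeroMeasure_of_riemannHypothesis` (p131143), and
`signConeOscillatory_of_fakeZeroMeasure (fakeZeroMeasure_of_riemannHypothesis hRH) : SignConeOscillatory` is the
line's own proof of `RH → crux`; so no `stub_fakeZeroMeasure_false` exists short of `¬RH`, and the terminal stub
is RH-equivalent given the sibling cruxes (p128545). -/

end Summit.RiemannHypothesis.RiemannHypothesis.Theorems.SignConeOscillatory

end
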